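import Literature.NumberTheory.Rogawski1990.LocalStableClassesNonsplitKappa
import Literature.NumberTheory.Rogawski1990.LocalStableClassesNonsplitTypeTwoCount
import Literature.NumberTheory.Rogawski1990.FinExplicitTransferFactorGHRegular
import HarnessLib

/-!
# `κ_v` on the TWO classes of a type-(2) local stable class: Rogawski's (4.3.2) in the `(2,1)` block frame — the class of `γ′` keeps the sign, the other
# class flips it (Rogawski 1990, §4.3 (4.3.2) p. 43, §3.5 Prop. 3.5.2 (c) p. 29, §3.6 p. 31, §4.9 Prop. 4.9.1 p. 55, p. 78 «type (2): the non-trivial `κ` is `H`'s»)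

Topic `NumberTheory/Rogawski1990`; namespace `Literature.NumberTheory.Rogawski1990`.  THEOREMS ONLY (no definition, no named fact, no instance, no notation, no
`sorry`).  Cell `pub/hodgecm-mathlib`, P3a road «D-N7-inert», brick (L4a)∕(D5): the TYPE-(2) FEEDER of the (D5)-junction «`κ_v` as a character on the local class
set» (pen F0P3-p02, ★ `LocalStableClassesNonsplitKappa`: (4.3.2) in a type-(1) EIGENFRAME), over ★ `LocalStableClassesNonsplitTypeTwoCount` (B-p14: the two classes
`[γ′]`, `[δ₀]`, block frame `γ′ P = P [A 0; 0 u]`, `χ_A` irreducible) and ★ `StableClassesTypeTwoFrame` (`H′_P = [G₁ 0; 0 g₃]`, Cartan class `P [Y 0; 0 t] P⁻¹`,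
`H′_{gP} = [G₁Y 0; 0 g₃t]`).  HC_CM is proved only modulo the printed citations until rung 0 closes; this file is unconditional local algebra.
In the CM carriers of ★ `finKappaAt` (`v` non-split, `γ_H = a`, `γ′ = b`, `γ″ = b′ = g γ′ g⁻¹`): if `γ′ P = P [A 0; 0 u]` with `u = γ₂` THE `U(1)`-eigenvalue of `γ_H`
(its eigenline is the column `j = e(inr 0)` of `P`), then both signs read on that column (★ `finKappaAt_eq_ite_twistGram_of_conj_eq`): `κ_v(γ_H, γ″) = κ_v(γ_H, γ′)`
iff `(H′_{gP})_{jj} ∈ N(E_v^×)·(H′_P)_{jj}` (§3 `finKappaAt_conj_eq_iff_normTest_blockFrame`) iff the CORNER `t` is a norm (`finKappaAt_conj_eq_iff_corner_norm`) iff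
`γ″` is conjugate to `γ′` (§2 `isConj_iff_exists_corner_norm`, the criterion inside ★ `exists_isStablyConj_not_isConj_and_forall`, exposed; `finKappaAt_eq_iff_isConj`);
so the other class `[δ₀]` carries `−κ_v(γ_H, γ′)` (`exists_isStablyConj_finKappaAt_eq_neg`): `κ` IS the non-trivial character of `𝓔(T_K × E¹ ∕ F_v) ≅ ℤ∕2`.

## References
* [Rogawski1990] J. D. Rogawski, *Automorphic Representations of Unitary Groups in Three Variables*, Ann. of Math. Stud. 123 (1990), §3.5 Prop. 3.5.2 (c) p. 29,
  §3.6 p. 31, §4.3 (4.3.2) p. 43, §4.9 Prop. 4.9.1 p. 55, p. 78.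
* [LanglandsShelstad1987] R. P. Langlands, D. Shelstad, *On the definition of transfer factors*, Math. Ann. 278 (1987), §1.
-/

set_option autoImplicit false

noncomputable section
open NumberField IsDedekindDomain Matrix
open scoped MatrixGroups

namespace Literature.NumberTheory.Rogawski1990

open Literature.NumberTheory.Automorphic Literature.NumberTheory.Automorphic.UnitaryGroup
open Literature.AlgebraicGeometry.ShimuraVarieties (unitaryGroup mem_unitaryGroup_iff)
/-! ## §1 Generic: the `u`-column of a `(2,1)` block frame is an eigenvector; `±1` bookkeeping -/
section Generic

variable {R : Type*} [CommRing R]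
/-- In a block frame `γ P = P [A 0; 0 u]` the column `j = e(inr 0)` of `P` is a `u`-eigenvector of `γ`. [cite: Rogawski1990, §3.6 p. 31] -/
theorem mulVec_col_eq_smul_of_blockFrame {m n : Type*} [Fintype m] [Fintype n] [DecidableEq n] (e : m ⊕ Fin 1 ≃ n)
    {γ P : Matrix n n R} {A : Matrix m m R} {u : R} (hP : γ * P = P * reindex e e (fromBlocks A 0 0 !![u])) :
    (γ *ᵥ fun i => P i (e (Sum.inr 0))) = u • fun i => P i (e (Sum.inr 0)) := by
  funext i
  have h := congrFun (congrFun hP i) (e (Sum.inr 0))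
  rw [Matrix.mul_apply, Matrix.mul_apply] at h
  rw [mulVec, dotProduct, h, Pi.smul_apply, smul_eq_mul, mul_comm]
  -- the column `e(inr 0)` of `[A 0; 0 u]` is `u` at `e(inr 0)` and `0` elsewhere
  have hcol : ∀ k : n, reindex e e (fromBlocks A 0 0 !![u]) k (e (Sum.inr 0)) = if k = e (Sum.inr 0) then u else 0 := by
    intro k
    rw [reindex_apply, submatrix_apply, Equiv.symm_apply_apply]
    obtain ⟨x, rfl⟩ := e.surjective k
    rw [Equiv.symm_apply_apply]
    rcases x with i | i
    · rw [fromBlocks_apply₁₂, if_neg (fun h => Sum.inl_ne_inr (e.injective h))]; rfl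
    · have hi : i = 0 := Subsingleton.elim _ _
      subst hi
      rw [fromBlocks_apply₂₂, if_pos rfl]; rfl
  simp_rw [hcol, mul_ite, mul_zero, Finset.sum_ite_eq', Finset.mem_univ, if_true]

/-- A column of an invertible matrix is non-zero. [folklore] -/
private theorem col_ne_zero {n : Type*} [Fintype n] [DecidableEq n] [Nontrivial R] (P : GL n R) (j : n) : (fun i => P.val i j) ≠ 0 := by
  intro h
  have h1 : ((P⁻¹).val * P.val) j j = 1 := by rw [← Units.val_mul, inv_mul_cancel, Units.val_one, one_apply_eq]
  rw [Matrix.mul_apply] at h1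
  have h0 : ∑ k, (P⁻¹).val j k * P.val k j = 0 := Finset.sum_eq_zero fun k _ => by rw [show P.val k j = 0 from congrFun h k, mul_zero]
  exact one_ne_zero (h1.symm.trans h0)

/-- `(±1 = ±1) ↔ (p ↔ q)`. [folklore] -/
private theorem ite_one_neg_one_eq_iff (p q : Prop) [Decidable p] [Decidable q] :
    ((if p then (1 : ℤ) else -1) = if q then 1 else -1) ↔ (p ↔ q) := by
  by_cases hp : p <;> by_cases hq : q <;> simp [hp, hq]

/-- `x = z σz` for a unit `z` iff `x = σz z · 1`. [folklore] -/
private theorem exists_eq_mul_map_iff (σ : R →+* R) (x : R) :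
    (∃ z : R, IsUnit z ∧ x = z * σ z) ↔ ∃ z : R, IsUnit z ∧ x = σ z * z * 1 :=
  exists_congr fun z => and_congr_right fun _ => by rw [mul_one, mul_comm]

/-- The corner entry of `[Y 0; 0 t]` in the frame. [cite: HornJohnson2013, §0.9.2 (block diagonal matrices and direct sums)] -/
theorem blockFrame_apply_corner {m n : Type*} (e : m ⊕ Fin 1 ≃ n) (Y : Matrix m m R) (t : R) :
    reindex e e (fromBlocks Y 0 0 !![t]) (e (Sum.inr 0)) (e (Sum.inr 0)) = t := by
  rw [reindex_apply, submatrix_apply, Equiv.symm_apply_apply, fromBlocks_apply₂₂]; rfl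

variable {K : Type*} [Field K] (σ : K →+* K)

/-- `P⁻¹ · P = 1` on matrices for `P ∈ GL_n`. [folklore] -/
private theorem coe_inv_mul_coe {n : Type*} [Fintype n] [DecidableEq n] (P : GL n K) : (P⁻¹).val * P.val = 1 := by
  rw [← Units.val_mul, inv_mul_cancel, Units.val_one]

/-- `P · P⁻¹ = 1` on matrices for `P ∈ GL_n`. [folklore] -/
private theorem coe_mul_coe_inv {n : Type*} [Fintype n] [DecidableEq n] (P : GL n K) : P.val * (P⁻¹).val = 1 := by
  rw [← Units.val_mul, mul_inv_cancel, Units.val_one]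

/-- `T⋆ · x` and `T⋆ · x · T` in a block-diagonal frame (as in ★ `…TypeTwoCount`, private there). [cite: Rogawski1990, §3.5 Prop. 3.5.2 (a) p. 29] -/
private theorem hermStar_mul_conj_blockFrame₂ {m n : Type*} [Fintype m] [DecidableEq m] [Fintype n] [DecidableEq n] (e : m ⊕ Fin 1 ≃ n)
    {H : Matrix n n K} {P : GL n K} {G₁ : Matrix m m K} {g₃ : K} (hT : twistGram σ H P.val = reindex e e (fromBlocks G₁ 0 0 !![g₃]))
    (hG₁ : IsUnit G₁.det) (hg₃ : g₃ ≠ 0) (S Y : Matrix m m K) (s t : K) :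
    hermStar σ H (P.val * reindex e e (fromBlocks S 0 0 !![s]) * (P⁻¹).val) * (P.val * reindex e e (fromBlocks Y 0 0 !![t]) * (P⁻¹).val) =
        P.val * reindex e e (fromBlocks (hermStar σ G₁ S * Y) 0 0 !![σ s * t]) * (P⁻¹).val ∧
      hermStar σ H (P.val * reindex e e (fromBlocks S 0 0 !![s]) * (P⁻¹).val) * (P.val * reindex e e (fromBlocks Y 0 0 !![t]) * (P⁻¹).val) *
          (P.val * reindex e e (fromBlocks S 0 0 !![s]) * (P⁻¹).val) =
        P.val * reindex e e (fromBlocks (hermStar σ G₁ S * Y * S) 0 0 !![σ s * t * s]) * (P⁻¹).val := by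
  have ePP : ∀ X : Matrix n n K, (P⁻¹).val * (P.val * X) = X := fun X => by rw [← Matrix.mul_assoc, coe_inv_mul_coe, Matrix.one_mul]
  rw [hermStar_conj_blockFrame σ e H hT hG₁ hg₃]
  constructor
  · simp only [Matrix.mul_assoc, ePP]
    rw [← Matrix.mul_assoc (reindex e e _), blockFrame_mul]
  · simp only [Matrix.mul_assoc, ePP]
    rw [← Matrix.mul_assoc (reindex e e _), blockFrame_mul, ← Matrix.mul_assoc (reindex e e _), blockFrame_mul]
    simp only [Matrix.mul_assoc]

/-- Norms `σ(z) z` of units form a group: quotient. [folklore] -/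
private theorem exists_norm_div (hσ : ∀ r, σ (σ r) = r) {a b z₁ z₂ : K} (hz₁ : IsUnit z₁) (hz₂ : IsUnit z₂) (ha : a = σ z₁ * z₁) (hab : a * b = σ z₂ * z₂) :
    ∃ z : K, IsUnit z ∧ b = σ z * z := by
  refine ⟨z₂ * z₁⁻¹, hz₂.mul (hz₁.ne_zero.isUnit.inv), ?_⟩
  have _ := hσ
  rw [map_mul, map_inv₀]
  field_simp [hz₁.ne_zero, (hz₁.map σ).ne_zero]
  linear_combination hab - b * ha

end Generic

/-! ## §2 The criterion (E∕F-generic): a stable conjugate is conjugate to `γ` iff the corner of its Cartan class is a norm -/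
section Criterion

variable {F : Type} (E : Type) [Field F] [NumberField F] [Field E] [NumberField E] [Algebra F E]
  [Algebra.IsQuadraticExtension F E] (v : HeightOneSpectrum (𝓞 F)) (c : E ≃ₐ[F] E) {δ : E} (hcδ : c δ = -δ) (hδ : δ ≠ 0)
variable {H : Matrix (Fin 3) (Fin 3) (LocalRing E v)} {γ P : GL (Fin 3) (LocalRing E v)} (e : Fin 2 ⊕ Fin 1 ≃ Fin 3)
  {A : Matrix (Fin 2) (Fin 2) (LocalRing E v)} {u : LocalRing E v}

include hcδ hδ in
/-- **CONJUGATE TO `γ` IFF THE CORNER IS A NORM** (type (2), non-split `v`; block frame `γ P = P [A 0; 0 u]`, `χ_A` irreducible, `H_P = [G₁ 0; 0 g₃]`, stable conjugator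
`g` with Cartan class `P⁻¹ (H⁻¹ H_g) P = [α + βA 0; 0 t]`): `g γ g⁻¹ ∼ γ` in `U(H)(F_v)` iff `t = σ(s) s` for a unit `s` ((⇒) `T⋆ x T = 1` in the corner; (⇐) `det Y` a norm,
`Y = S⋆S` by ★ (N2), `x = T⋆T`). [cite: Rogawski1990, §3.1 p. 19; §3.5 Prop. 3.5.2 (a)(c) p. 29; §3.6 p. 31] -/
theorem isConj_iff_exists_corner_norm (w : PlacesOver E v) (hw : c • w.1 = w.1) {d : F} (hd : δ * δ = algebraMap F E d)
    (hH : (H.map (conjLocal E c v))ᵀ = H) (hHd : IsUnit H.det)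
    (hγ : γ ∈ unitaryGroup (conjLocal E c v) H) (hP : γ.val * P.val = P.val * reindex e e (fromBlocks A 0 0 !![u])) (hA : Irreducible A.charpoly)
    {G₁ : Matrix (Fin 2) (Fin 2) (LocalRing E v)} {g₃ : LocalRing E v} (hT : twistGram (conjLocal E c v) H P.val = reindex e e (fromBlocks G₁ 0 0 !![g₃]))
    {g : GL (Fin 3) (LocalRing E v)} (hg : g * γ * g⁻¹ ∈ unitaryGroup (conjLocal E c v) H) {α β t : LocalRing E v}
    (hx : (P⁻¹).val * (H⁻¹ * twistGram (conjLocal E c v) H g.val) * P.val = reindex e e (fromBlocks (α • 1 + β • A) 0 0 !![t])) :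
    IsConj (⟨γ, hγ⟩ : unitaryGroup (conjLocal E c v) H) ⟨g * γ * g⁻¹, hg⟩ ↔ ∃ s : LocalRing E v, IsUnit s ∧ t = conjLocal E c v s * s := by
  letI : Field (LocalRing E v) := (Liu2021.LemD1IndexedNonVacuityNonsplitPlace.isField_localRing_of_nonsplit E v c hcδ hδ w hw).toField
  have hσσ : ∀ x : LocalRing E v, conjLocal E c v (conjLocal E c v x) = x := Liu2021.LemD1OfPlace.conjLocal_conjLocal_apply E v c hcδ hδ
  have hA' : ∀ r : LocalRing E v, A.charpoly.eval r ≠ 0 := Literature.LinearAlgebra.Matrix.eval_charpoly_ne_zero_of_irreducible hA (by simp)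
  obtain ⟨hG₁h, hg₃σ, hG₁d, hg₃0⟩ := blockFrame_gram_hermitian (conjLocal E c v) e H hσσ hH hHd.ne_zero hT
  have hG₁u : IsUnit G₁.det := Ne.isUnit hG₁d
  -- facts about this Cartan class
  obtain ⟨α', β', t', hxP', hYs, htσ, hdet, ht0, hYu⟩ := exists_cartan_blockFrame_eq E v c hcδ hδ e w hw hH hHd hγ hP hA hT hg
  rw [hx, blockFrame_inj] at hxP'
  obtain ⟨hYY, rfl⟩ := hxP'
  rw [← hYY] at hYs hdet hYu
  have hgd : IsUnit g.val.det := by have h := g.isUnit; rwa [Matrix.isUnit_iff_isUnit_det] at h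
  have ePP' : ∀ X : Matrix (Fin 3) (Fin 3) (LocalRing E v), P.val * ((P⁻¹).val * X) = X := fun X => by
    rw [← Matrix.mul_assoc, coe_mul_coe_inv, Matrix.one_mul]
  have hxx : H⁻¹ * twistGram (conjLocal E c v) H g.val = P.val * reindex e e (fromBlocks (α • 1 + β • A) 0 0 !![t]) * (P⁻¹).val := by
    rw [← hx]; simp only [Matrix.mul_assoc, coe_mul_coe_inv, Matrix.mul_one, ePP']
  -- `A` is unitary for `G₁`: from the frame of `twistGram_blockFrame_eq` (same `G₁` by `blockFrame_inj`)
  obtain ⟨G₁', g₃', hT2, hAu2, -⟩ := twistGram_blockFrame_eq (conjLocal E c v) e H hσσ hγ hP hA'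
  rw [hT, blockFrame_inj] at hT2
  obtain ⟨rfl, rfl⟩ := hT2
  constructor
  · -- (⇒) `T⋆ x T = 1`, read in the corner
    intro hconj
    obtain ⟨uu, huu, huc⟩ : ∃ uu : GL (Fin 3) (LocalRing E v), uu ∈ unitaryGroup (conjLocal E c v) H ∧ uu * γ * uu⁻¹ = g * γ * g⁻¹ := by
      obtain ⟨cc, hcc⟩ := isConj_iff.1 hconj
      exact ⟨cc.val, cc.2, congrArg Subtype.val hcc⟩
    obtain ⟨T, hTγ, hT1⟩ := (exists_unitary_conj_iff_exists_hermStar_mul_mul_eq_one (conjLocal E c v) H hHd (γ := γ) (δ := g * γ * g⁻¹) (g := g) rfl).1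
      ⟨uu, huu, huc⟩
    have hTc : Commute T.val γ.val := by
      show T.val * γ.val = γ.val * T.val
      rw [← Units.val_mul, hTγ, Units.val_mul]
    obtain ⟨αT, βT, s, hTP⟩ := (Literature.LinearAlgebra.Matrix.commute_iff_exists_smul_one_add_smul_of_irreducible hP hA).1 hTc
    rw [hxx, hTP, (hermStar_mul_conj_blockFrame₂ (conjLocal E c v) e hT hG₁u hg₃0 _ _ s t).2] at hT1
    have hT1' := congrArg (fun M => (P⁻¹).val * M * P.val) hT1
    simp only [Matrix.mul_assoc, coe_inv_mul_coe, Matrix.mul_one] at hT1'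
    rw [← Matrix.mul_assoc, coe_inv_mul_coe, Matrix.one_mul, ← blockFrame_one e, blockFrame_inj] at hT1'
    have hs0 : s ≠ 0 := by
      intro h0; have h := hT1'.2; rw [h0, mul_zero] at h; exact zero_ne_one h
    have hsu : IsUnit s := Ne.isUnit hs0
    -- `t = σ(z) z` with `z = s⁻¹` (as a unit inverse)
    refine ⟨((hsu.unit⁻¹ : (LocalRing E v)ˣ) : LocalRing E v), Units.isUnit _, ?_⟩
    set z : LocalRing E v := ((hsu.unit⁻¹ : (LocalRing E v)ˣ) : LocalRing E v) with hzdef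
    have hzs : z * s = 1 := hsu.val_inv_mul
    have hσzs : conjLocal E c v z * conjLocal E c v s = 1 := by rw [← map_mul, hzs, map_one]
    have hsz : s * z = 1 := by rw [mul_comm]; exact hzs
    calc t = conjLocal E c v z * conjLocal E c v s * t * (s * z) := by rw [hσzs, hsz, one_mul, mul_one]
      _ = conjLocal E c v z * (conjLocal E c v s * t * s) * z := by ring
      _ = conjLocal E c v z * z := by rw [hT1'.2, mul_one]
  · -- (⇐) the corner is a norm ⇒ `det Y` is a norm ⇒ `Y = S⋆S` ⇒ `x = T⋆ T`
    rintro ⟨s, hs, hts⟩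
    obtain ⟨z, hz, hYz⟩ : ∃ z : LocalRing E v, IsUnit z ∧ (α • (1 : Matrix (Fin 2) (Fin 2) (LocalRing E v)) + β • A).det = conjLocal E c v z * z :=
      exists_norm_div (conjLocal E c v) hσσ hs hgd hts (by rw [mul_comm]; exact hdet)
    obtain ⟨α₁, β₁, hSu, hYS⟩ := exists_eq_hermStar_mul_self_of_det_norm E v c hcδ hδ hd w hw hG₁h hG₁u hAu2 hA' hYs ⟨z, hz, hYz⟩
    set T : GL (Fin 3) (LocalRing E v) := Matrix.GeneralLinearGroup.mkOfDetNeZero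
      (P.val * reindex e e (fromBlocks (α₁ • 1 + β₁ • A) 0 0 !![s]) * (P⁻¹).val)
      (by rw [det_conj_blockFrame]; exact mul_ne_zero hSu.ne_zero hs.ne_zero) with hTdef
    have hTval : T.val = P.val * reindex e e (fromBlocks (α₁ • 1 + β₁ • A) 0 0 !![s]) * (P⁻¹).val := rfl
    have hTγ : T * γ = γ * T := Units.ext (commute_conj_blockFrame e hP (Literature.LinearAlgebra.Matrix.commute_smul_one_add_smul A α₁ β₁) s).eq
    have h1 : H⁻¹ * twistGram (conjLocal E c v) H g.val =
        hermStar (conjLocal E c v) H T.val * (H⁻¹ * twistGram (conjLocal E c v) H (1 : GL (Fin 3) (LocalRing E v)).val) * T.val := by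
      rw [Units.val_one, twistGram_one, Matrix.nonsing_inv_mul H hHd, Matrix.mul_one, hTval,
        (hermStar_mul_conj_blockFrame₂ (conjLocal E c v) e hT hG₁u hg₃0 _ _ s s).1, hxx, hYS, hts]
    obtain ⟨uu, huu, huc⟩ := exists_unitary_conj_of_inv_mul_twistGram_eq (conjLocal E c v) H hHd (γ := γ) (δ := γ) (g := 1)
      (by rw [one_mul, inv_one, mul_one]) (rfl : g * γ * g⁻¹ = g * γ * g⁻¹) hTγ h1
    exact (isConj_iff.2 ⟨⟨uu, huu⟩, Subtype.ext huc⟩ : IsConj (⟨g * γ * g⁻¹, hg⟩ : unitaryGroup (conjLocal E c v) H) ⟨γ, hγ⟩).symm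

end Criterion

/-! ## §3 `κ_v` on the two classes (CM carriers of ★ `finKappaAt`) -/

section Kappa

variable (L : Type) [Field L] [NumberField L] [IsCMField L] (v : HeightOneSpectrum (𝓞 ↥(maximalRealSubfield L)))
  (H' : Matrix (Fin 3) (Fin 3) L)
  (a : (UnitaryGroup.cmDatum L 2 (Matrix.of fun i j : Fin 2 => if i.val + j.val + 1 = 2 then (1 : L) else 0)).Local v ×
      (UnitaryGroup.cmDatum L 1 (Matrix.of fun i j : Fin 1 => if i.val + j.val + 1 = 1 then (1 : L) else 0)).Local v)
  (b b' : (UnitaryGroup.cmDatum L 3 H').Local v)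

/-- A CM field has a non-zero element negated by complex conjugation (as in ★ `LocalStableClassesNonsplitKappa`, private there). [cite: Rogawski1990, §1.10] -/
private theorem exists_complexConj_eq_neg_ne_zero' : ∃ δ : L, IsCMField.complexConj L δ = -δ ∧ δ ≠ 0 := by
  obtain ⟨ζ, hζ⟩ := not_forall.1 fun h0 => IsCMField.complexConj_ne_one L (AlgEquiv.ext h0)
  refine ⟨ζ - IsCMField.complexConj L ζ, by rw [map_sub, IsCMField.complexConj_apply_apply, neg_sub], fun h0 => hζ ?_⟩
  rw [sub_eq_zero] at h0
  exact h0.symm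

/-- `δ² ∈ L⁺`. [folklore] -/
private theorem exists_delta_sq {δ : L} (hcδ : IsCMField.complexConj L δ = -δ) (hδ : δ ≠ 0) :
    ∃ d : ↥(maximalRealSubfield L), δ * δ = algebraMap (↥(maximalRealSubfield L)) L d := by
  obtain ⟨x, y, hxy⟩ := exists_eq_add_mul_of_isQuadraticExtension (F := ↥(maximalRealSubfield L)) (E := L)
    (not_mem_range_algebraMap_of_apply_eq_neg L (IsCMField.complexConj L) hcδ hδ) (δ * δ)
  have hc2 : IsCMField.complexConj L (δ * δ) = δ * δ := by rw [map_mul, hcδ, neg_mul_neg]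
  have hy : algebraMap (↥(maximalRealSubfield L)) L y * δ = 0 := by
    have h1 : IsCMField.complexConj L (δ * δ) = algebraMap _ L x - algebraMap _ L y * δ := by
      rw [hxy, map_add, map_mul, AlgEquiv.commutes, AlgEquiv.commutes, hcδ, mul_neg, sub_eq_add_neg]
    rw [hc2, hxy] at h1
    have h2 : (2 : L) * (algebraMap _ L y * δ) = 0 := by linear_combination h1
    exact (mul_eq_zero.1 h2).resolve_left two_ne_zero
  exact ⟨x, by rw [hxy, hy, add_zero]⟩

open scoped Classical in
/-- **ROGAWSKI'S (4.3.2) ON A TYPE-(2) LOCAL CLASS SET, IN THE BLOCK FRAME** (non-split `v`; matching pair `ι_v(γ_H) ↔ γ′`, `χ_g(u)` a unit; `γ′ P = P [A 0; 0 u]`,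
`u = γ₂` the `U(1)`-eigenvalue of `γ_H`, `χ_A` irreducible; `g γ′ g⁻¹ = γ″`): `κ_v(γ_H, γ″) = κ_v(γ_H, γ′)` iff the norm test «`(H′_{gP})_{jj} ∈ N · (H′_P)_{jj}`» at the
`u`-column `j = e(inr 0)` passes — the type-(2) twin of ★ `finKappaAt_conj_eq_iff_normTest` (both signs on that column by ★ `finKappaAt_eq_ite_twistGram_of_conj_eq`,
index two by ★ `exists_norm_mul_iff_norm_tests_iff`). [cite: Rogawski1990, §4.3 (4.3.2) p. 43; §3.5 Prop. 3.5.2 (c) p. 29; §4.9 Prop. 4.9.1 p. 55] [cite: LanglandsShelstad1987, §1] -/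
theorem finKappaAt_conj_eq_iff_normTest_blockFrame (w : UnitaryGroup.PlacesOver L v) (hw : IsCMField.complexConj L • w.1 = w.1)
    (h : IsLocalNormPair L H' v a b) (hu : IsUnit ((finCharpolyTwo L v a).eval (finGammaTwo L v a)))
    (hH : (((UnitaryGroup.adelicForm L 3 H').map (UnitaryGroup.adeleToLocal L v)).map
      (UnitaryGroup.conjLocal L (IsCMField.complexConj L) v))ᵀ = (UnitaryGroup.adelicForm L 3 H').map (UnitaryGroup.adeleToLocal L v))
    (hHd : IsUnit ((UnitaryGroup.adelicForm L 3 H').map (UnitaryGroup.adeleToLocal L v)).det) (e : Fin 2 ⊕ Fin 1 ≃ Fin 3)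
    {P : GL (Fin 3) (UnitaryGroup.LocalRing L v)} {A : Matrix (Fin 2) (Fin 2) (UnitaryGroup.LocalRing L v)}
    (hP : (b.val.val : Matrix (Fin 3) (Fin 3) (UnitaryGroup.LocalRing L v)) * P.val = P.val * reindex e e (fromBlocks A 0 0 !![finGammaTwo L v a]))
    (hA : Irreducible A.charpoly) {g : GL (Fin 3) (UnitaryGroup.LocalRing L v)} (hg : g * b.val * g⁻¹ = b'.val) :
    finKappaAt L v H' a b' = finKappaAt L v H' a b ↔
      ∃ z : UnitaryGroup.LocalRing L v, IsUnit z ∧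
        twistGram (UnitaryGroup.conjLocal L (IsCMField.complexConj L) v)
            ((UnitaryGroup.adelicForm L 3 H').map (UnitaryGroup.adeleToLocal L v)) (g.val * P.val) (e (Sum.inr 0)) (e (Sum.inr 0)) =
          UnitaryGroup.conjLocal L (IsCMField.complexConj L) v z * z *
            twistGram (UnitaryGroup.conjLocal L (IsCMField.complexConj L) v)
              ((UnitaryGroup.adelicForm L 3 H').map (UnitaryGroup.adeleToLocal L v)) P.val (e (Sum.inr 0)) (e (Sum.inr 0)) := by
  classical
  obtain ⟨δ, hcδ, hδ⟩ := exists_complexConj_eq_neg_ne_zero' L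
  have hv : Subsingleton (UnitaryGroup.PlacesOver L v) :=
    UnitaryGroup.PlacesOver.subsingleton_of_smul_eq (IsCMField.complexConj L) (IsCMField.complexConj_ne_one L) w hw
  have hσσ : ∀ s, UnitaryGroup.conjLocal L (IsCMField.complexConj L) v (UnitaryGroup.conjLocal L (IsCMField.complexConj L) v s) = s :=
    Liu2021.LemD1OfPlace.conjLocal_conjLocal_apply L v (IsCMField.complexConj L) hcδ hδ
  letI : Field (UnitaryGroup.LocalRing L v) :=
    (Liu2021.LemD1IndexedNonVacuityNonsplitPlace.isField_localRing_of_nonsplit L v (IsCMField.complexConj L) hcδ hδ w hw).toField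
  set σ := UnitaryGroup.conjLocal L (IsCMField.complexConj L) v with hσdef
  set Hv := (UnitaryGroup.adelicForm L 3 H').map (UnitaryGroup.adeleToLocal L v) with hHvdef
  have hA' : ∀ r : UnitaryGroup.LocalRing L v, A.charpoly.eval r ≠ 0 := Literature.LinearAlgebra.Matrix.eval_charpoly_ne_zero_of_irreducible hA (by simp)
  -- the `u`-column of `P`
  have hp' : (b.val.val : Matrix (Fin 3) (Fin 3) (UnitaryGroup.LocalRing L v)) *ᵥ (fun i => P.val i (e (Sum.inr 0))) =
      finGammaTwo L v a • fun i => P.val i (e (Sum.inr 0)) := mulVec_col_eq_smul_of_blockFrame e hP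
  have hne : (fun i => P.val i (e (Sum.inr 0))) ≠ 0 := col_ne_zero P _
  -- both signs on that column
  have hb' := finKappaAt_eq_ite_twistGram_of_conj_eq L v H' a b b' hv h hu hp' hne hg
  have hb0 := finKappaAt_eq_ite_twistGram_of_conj_eq L v H' a b b hv h hu hp' hne (g := 1) (by rw [one_mul, inv_one, mul_one])
  rw [sum_sum_map_col_mul_mul_col_eq_twistGram_apply] at hb' hb0
  have htw : twistGram σ (twistGram σ Hv g.val) P.val = twistGram σ Hv (g.val * P.val) := by rw [twistGram_mul]; rfl
  have htw1 : twistGram σ (twistGram σ Hv (1 : GL (Fin 3) (UnitaryGroup.LocalRing L v)).val) P.val = twistGram σ Hv P.val := by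
    rw [Units.val_one, twistGram_one]
  rw [htw] at hb'
  rw [htw1] at hb0
  -- the two entries are `σ`-fixed units: `(H′_P)_{jj} = g₃ ≠ 0`, `(H′_{gP})_{jj} = g₃ t ≠ 0`
  obtain ⟨G₁, g₃, hT, -, -⟩ := twistGram_blockFrame_eq σ e Hv hσσ b.2 hP hA'
  obtain ⟨-, hg₃σ, -, hg₃0⟩ := blockFrame_gram_hermitian σ e Hv hσσ hH hHd.ne_zero hT
  have hgU : g * b.val * g⁻¹ ∈ unitaryGroup σ Hv := by rw [hg]; exact b'.2
  obtain ⟨α, β, t, hxP, -, htσ, -, ht0, -⟩ := exists_cartan_blockFrame_eq L v (IsCMField.complexConj L) hcδ hδ e w hw hH hHd b.2 hP hA hT hgU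
  have hjj : twistGram σ Hv P.val (e (Sum.inr 0)) (e (Sum.inr 0)) = g₃ := by rw [hT, blockFrame_apply_corner]
  have hjj' : twistGram σ Hv (g.val * P.val) (e (Sum.inr 0)) (e (Sum.inr 0)) = g₃ * t := by
    rw [twistGram_mul_blockFrame_eq σ e Hv hHd hT hxP, blockFrame_apply_corner]
  have hau : IsUnit (twistGram σ Hv P.val (e (Sum.inr 0)) (e (Sum.inr 0))) :=
    isUnit_localRing_of_ne_zero_of_subsingleton L v hv (by rw [hjj]; exact hg₃0)
  have ha'u : IsUnit (twistGram σ Hv (g.val * P.val) (e (Sum.inr 0)) (e (Sum.inr 0))) :=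
    isUnit_localRing_of_ne_zero_of_subsingleton L v hv (by rw [hjj']; exact mul_ne_zero hg₃0 ht0)
  have ha := map_twistGram_apply_self σ Hv hσσ hH P.val (e (Sum.inr 0))
  have ha' := map_twistGram_apply_self σ Hv hσσ hH (g.val * P.val) (e (Sum.inr 0))
  rw [hb', hb0, ite_one_neg_one_eq_iff, exists_eq_mul_map_iff, exists_eq_mul_map_iff]
  exact (exists_norm_mul_iff_norm_tests_iff L v (IsCMField.complexConj L) hcδ hδ w hw ha hau ha' ha'u (map_one _) isUnit_one).symm

open scoped Classical in
/-- **… IFF THE CORNER OF THE CARTAN CLASS IS A NORM**: with `P⁻¹ (H′⁻¹ H′_g) P = [α + βA 0; 0 t]`, `κ_v(γ_H, g γ′ g⁻¹) = κ_v(γ_H, γ′) ↔ t = σ(z) z` for a unit `z`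
(`(H′_{gP})_{jj} = g₃ t`, `(H′_P)_{jj} = g₃ ≠ 0`). [cite: Rogawski1990, §4.3 (4.3.2) p. 43; §3.5 Prop. 3.5.2 (c) p. 29] -/
theorem finKappaAt_conj_eq_iff_corner_norm (w : UnitaryGroup.PlacesOver L v) (hw : IsCMField.complexConj L • w.1 = w.1)
    (h : IsLocalNormPair L H' v a b) (hu : IsUnit ((finCharpolyTwo L v a).eval (finGammaTwo L v a)))
    (hH : (((UnitaryGroup.adelicForm L 3 H').map (UnitaryGroup.adeleToLocal L v)).map
      (UnitaryGroup.conjLocal L (IsCMField.complexConj L) v))ᵀ = (UnitaryGroup.adelicForm L 3 H').map (UnitaryGroup.adeleToLocal L v))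
    (hHd : IsUnit ((UnitaryGroup.adelicForm L 3 H').map (UnitaryGroup.adeleToLocal L v)).det) (e : Fin 2 ⊕ Fin 1 ≃ Fin 3)
    {P : GL (Fin 3) (UnitaryGroup.LocalRing L v)} {A : Matrix (Fin 2) (Fin 2) (UnitaryGroup.LocalRing L v)}
    (hP : (b.val.val : Matrix (Fin 3) (Fin 3) (UnitaryGroup.LocalRing L v)) * P.val = P.val * reindex e e (fromBlocks A 0 0 !![finGammaTwo L v a]))
    (hA : Irreducible A.charpoly) {g : GL (Fin 3) (UnitaryGroup.LocalRing L v)} (hg : g * b.val * g⁻¹ = b'.val) {α β t : UnitaryGroup.LocalRing L v}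
    (hx : (P⁻¹).val * (((UnitaryGroup.adelicForm L 3 H').map (UnitaryGroup.adeleToLocal L v))⁻¹ *
        twistGram (UnitaryGroup.conjLocal L (IsCMField.complexConj L) v) ((UnitaryGroup.adelicForm L 3 H').map (UnitaryGroup.adeleToLocal L v)) g.val) *
          P.val = reindex e e (fromBlocks (α • 1 + β • A) 0 0 !![t])) :
    finKappaAt L v H' a b' = finKappaAt L v H' a b ↔
      ∃ z : UnitaryGroup.LocalRing L v, IsUnit z ∧ t = UnitaryGroup.conjLocal L (IsCMField.complexConj L) v z * z := by
  obtain ⟨δ, hcδ, hδ⟩ := exists_complexConj_eq_neg_ne_zero' L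
  have hσσ : ∀ s, UnitaryGroup.conjLocal L (IsCMField.complexConj L) v (UnitaryGroup.conjLocal L (IsCMField.complexConj L) v s) = s :=
    Liu2021.LemD1OfPlace.conjLocal_conjLocal_apply L v (IsCMField.complexConj L) hcδ hδ
  letI : Field (UnitaryGroup.LocalRing L v) :=
    (Liu2021.LemD1IndexedNonVacuityNonsplitPlace.isField_localRing_of_nonsplit L v (IsCMField.complexConj L) hcδ hδ w hw).toField
  have hA' : ∀ r : UnitaryGroup.LocalRing L v, A.charpoly.eval r ≠ 0 := Literature.LinearAlgebra.Matrix.eval_charpoly_ne_zero_of_irreducible hA (by simp)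
  rw [finKappaAt_conj_eq_iff_normTest_blockFrame L v H' a b b' w hw h hu hH hHd e hP hA hg]
  obtain ⟨G₁, g₃, hT, -, -⟩ := twistGram_blockFrame_eq (UnitaryGroup.conjLocal L (IsCMField.complexConj L) v) e _ hσσ b.2 hP hA'
  obtain ⟨-, -, -, hg₃0⟩ := blockFrame_gram_hermitian (UnitaryGroup.conjLocal L (IsCMField.complexConj L) v) e _ hσσ hH hHd.ne_zero hT
  rw [twistGram_mul_blockFrame_eq (UnitaryGroup.conjLocal L (IsCMField.complexConj L) v) e _ hHd hT hx, blockFrame_apply_corner, hT,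
    blockFrame_apply_corner]
  refine exists_congr fun z => and_congr_right fun _ => ?_
  rw [mul_comm g₃ t]
  exact mul_left_inj' hg₃0

/-- **`κ_v` SEPARATES THE TWO CLASSES**: for `γ″ = g γ′ g⁻¹` stably conjugate to the type-(2) `γ′`, `κ_v(γ_H, γ″) = κ_v(γ_H, γ′)` iff `γ″` is `G′_v`-conjugate to `γ′`
(`isConj_iff_exists_corner_norm` + `finKappaAt_conj_eq_iff_corner_norm`).  [cite: Rogawski1990, §4.3 (4.3.2) p. 43; §4.9 Prop. 4.9.1 p. 55] -/
theorem finKappaAt_eq_iff_isConj (w : UnitaryGroup.PlacesOver L v) (hw : IsCMField.complexConj L • w.1 = w.1)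
    (h : IsLocalNormPair L H' v a b) (hu : IsUnit ((finCharpolyTwo L v a).eval (finGammaTwo L v a)))
    (hH : (((UnitaryGroup.adelicForm L 3 H').map (UnitaryGroup.adeleToLocal L v)).map
      (UnitaryGroup.conjLocal L (IsCMField.complexConj L) v))ᵀ = (UnitaryGroup.adelicForm L 3 H').map (UnitaryGroup.adeleToLocal L v))
    (hHd : IsUnit ((UnitaryGroup.adelicForm L 3 H').map (UnitaryGroup.adeleToLocal L v)).det) (e : Fin 2 ⊕ Fin 1 ≃ Fin 3)
    {P : GL (Fin 3) (UnitaryGroup.LocalRing L v)} {A : Matrix (Fin 2) (Fin 2) (UnitaryGroup.LocalRing L v)}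
    (hP : (b.val.val : Matrix (Fin 3) (Fin 3) (UnitaryGroup.LocalRing L v)) * P.val = P.val * reindex e e (fromBlocks A 0 0 !![finGammaTwo L v a]))
    (hA : Irreducible A.charpoly) {g : GL (Fin 3) (UnitaryGroup.LocalRing L v)} (hg : g * b.val * g⁻¹ = b'.val) :
    finKappaAt L v H' a b' = finKappaAt L v H' a b ↔
      IsConj (⟨b.val, b.2⟩ : unitaryGroup (UnitaryGroup.conjLocal L (IsCMField.complexConj L) v)
        ((UnitaryGroup.adelicForm L 3 H').map (UnitaryGroup.adeleToLocal L v))) ⟨b'.val, b'.2⟩ := by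
  obtain ⟨δ, hcδ, hδ⟩ := exists_complexConj_eq_neg_ne_zero' L
  obtain ⟨d, hd⟩ := exists_delta_sq L hcδ hδ
  have hσσ : ∀ s, UnitaryGroup.conjLocal L (IsCMField.complexConj L) v (UnitaryGroup.conjLocal L (IsCMField.complexConj L) v s) = s :=
    Liu2021.LemD1OfPlace.conjLocal_conjLocal_apply L v (IsCMField.complexConj L) hcδ hδ
  letI : Field (UnitaryGroup.LocalRing L v) :=
    (Liu2021.LemD1IndexedNonVacuityNonsplitPlace.isField_localRing_of_nonsplit L v (IsCMField.complexConj L) hcδ hδ w hw).toField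
  set σ := UnitaryGroup.conjLocal L (IsCMField.complexConj L) v with hσdef
  set Hv := (UnitaryGroup.adelicForm L 3 H').map (UnitaryGroup.adeleToLocal L v) with hHvdef
  have hA' : ∀ r : UnitaryGroup.LocalRing L v, A.charpoly.eval r ≠ 0 := Literature.LinearAlgebra.Matrix.eval_charpoly_ne_zero_of_irreducible hA (by simp)
  obtain ⟨G₁, g₃, hT, -, -⟩ := twistGram_blockFrame_eq σ e Hv hσσ b.2 hP hA'
  have hgU : g * b.val * g⁻¹ ∈ unitaryGroup σ Hv := by rw [hg]; exact b'.2
  obtain ⟨α, β, t, hxP, -⟩ := exists_cartan_blockFrame_eq L v (IsCMField.complexConj L) hcδ hδ e w hw hH hHd b.2 hP hA hT hgU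
  have h1 := finKappaAt_conj_eq_iff_corner_norm L v H' a b b' w hw h hu hH hHd e hP hA hg hxP
  have h2 := isConj_iff_exists_corner_norm L v (IsCMField.complexConj L) hcδ hδ e w hw hd hH hHd b.2 hP hA hT hgU hxP
  have heq : (⟨g * b.val * g⁻¹, hgU⟩ : unitaryGroup σ Hv) = ⟨b'.val, b'.2⟩ := Subtype.ext hg
  rw [heq] at h2
  exact h1.trans h2.symm

/-- **THE OTHER CLASS FLIPS THE SIGN**: some `δ₀ ∈ G′_v` stably conjugate, not conjugate to the type-(2) `γ′` has `κ_v(γ_H, δ₀) = −κ_v(γ_H, γ′)` — `κ` is the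
non-trivial character of `𝓔(T_K × E¹ ∕ F_v) ≅ ℤ∕2` [Prop. 4.9.1; p. 78]. [cite: Rogawski1990, §3.5 Prop. 3.5.2 (c) p. 29; §4.3 (4.3.2) p. 43; §4.9 Prop. 4.9.1 p. 55] -/
theorem exists_isStablyConj_finKappaAt_eq_neg (w : UnitaryGroup.PlacesOver L v) (hw : IsCMField.complexConj L • w.1 = w.1)
    (h : IsLocalNormPair L H' v a b) (hu : IsUnit ((finCharpolyTwo L v a).eval (finGammaTwo L v a)))
    (hH : (((UnitaryGroup.adelicForm L 3 H').map (UnitaryGroup.adeleToLocal L v)).map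
      (UnitaryGroup.conjLocal L (IsCMField.complexConj L) v))ᵀ = (UnitaryGroup.adelicForm L 3 H').map (UnitaryGroup.adeleToLocal L v))
    (hHd : IsUnit ((UnitaryGroup.adelicForm L 3 H').map (UnitaryGroup.adeleToLocal L v)).det) (e : Fin 2 ⊕ Fin 1 ≃ Fin 3)
    {P : GL (Fin 3) (UnitaryGroup.LocalRing L v)} {A : Matrix (Fin 2) (Fin 2) (UnitaryGroup.LocalRing L v)}
    (hP : (b.val.val : Matrix (Fin 3) (Fin 3) (UnitaryGroup.LocalRing L v)) * P.val = P.val * reindex e e (fromBlocks A 0 0 !![finGammaTwo L v a]))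
    (hA : Irreducible A.charpoly) :
    ∃ δ₀ : (UnitaryGroup.cmDatum L 3 H').Local v,
      IsStablyConj (UnitaryGroup.conjLocal L (IsCMField.complexConj L) v) ((UnitaryGroup.adelicForm L 3 H').map (UnitaryGroup.adeleToLocal L v))
          ⟨b.val, b.2⟩ ⟨δ₀.val, δ₀.2⟩ ∧
        ¬ IsConj (⟨b.val, b.2⟩ : unitaryGroup (UnitaryGroup.conjLocal L (IsCMField.complexConj L) v)
          ((UnitaryGroup.adelicForm L 3 H').map (UnitaryGroup.adeleToLocal L v))) ⟨δ₀.val, δ₀.2⟩ ∧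
        finKappaAt L v H' a δ₀ = -finKappaAt L v H' a b := by
  obtain ⟨δ, hcδ, hδ⟩ := exists_complexConj_eq_neg_ne_zero' L
  obtain ⟨δ₀, hst₀, hnc, -⟩ := exists_isStablyConj_not_isConj_and_forall L v (IsCMField.complexConj L) hcδ hδ e w hw hH hHd b.2 hP hA
  refine ⟨⟨δ₀.val, δ₀.2⟩, hst₀, hnc, ?_⟩
  obtain ⟨g, hg⟩ := isStablyConj_iff.1 hst₀
  have hne : finKappaAt L v H' a ⟨δ₀.val, δ₀.2⟩ ≠ finKappaAt L v H' a b := fun heq =>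
    hnc ((finKappaAt_eq_iff_isConj L v H' a b ⟨δ₀.val, δ₀.2⟩ w hw h hu hH hHd e hP hA hg).1 heq)
  have h' : IsLocalNormPair L H' v a ⟨δ₀.val, δ₀.2⟩ := isLocalNormPair_of_conj_eq L v H' a b _ h hg
  rcases finKappaAt_eq_one_or_eq_neg_one_of_isUnit L v H' a b h hu with h1 | h1 <;>
    rcases finKappaAt_eq_one_or_eq_neg_one_of_isUnit L v H' a _ h' hu with h2 | h2
  · exact absurd (h2.trans h1.symm) hne
  · rw [h1, h2]
  · rw [h1, h2]; norm_num
  · exact absurd (h2.trans h1.symm) hne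

end Kappa

end Literature.NumberTheory.Rogawski1990
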